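import Literature.AlgebraicGeometry.ModuliOfAbelianVarieties.SiegelFineModuliFibreTriples
import HarnessLib

/-!
# The `classify` bridge: morphisms `T → 𝒜_{g,δ,N}` through a point `x₀ = cls(P₀)` ↔ triples over `T` deforming `P₀`
# (MFK Def. 7.2 / Thm. 7.9: a FINE moduli scheme represents the functor of triples — relation form over a pointed base)

Layer `Literature/AlgebraicGeometry/ModuliOfAbelianVarieties`, namespace
`Literature.AlgebraicGeometry.ModuliOfAbelianVarieties.SiegelFineModuliScheme`.  THEOREMS ONLY (no definition, no named
fact, no instance).  Setting of `SiegelFineModuliScheme` (`𝓜.M : SchemeOver ℚ` with universal triple `𝓜.univ` and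
`classify : ∃! f : T ⟶ 𝓜.M, P' = f^* univ` for every triple `P'` over a locally noetherian `ℚ`-scheme `T` — [MumfordFogartyKirwan1994]
Prop. 7.6 / Thm. 7.9 «fine moduli scheme»), of the relation `PolarizedAbelianSchemeWithLevel.IsBaseChangeVia` (MFK Def. 7.2
«`𝒜_{g,d,n}(S)` forms a contravariant functor in `S`») and of `SiegelFineModuliFibreTriples` (same classifying map ⇒
isomorphic triples).

For a POINTED test scheme — a locally noetherian `ℚ`-scheme `T` with a morphism `ι : Spec ℂ → T` over `ℚ` (the closed point of
`Spec R`, `R` a local Artinian `ℂ`-algebra, is the case of deformation theory) — and a triple `P₀` over `Spec ℂ` with classifying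
point `x₀ = cls P₀`, the functor of points of `(𝓜.M, x₀)` and the deformation functor of `P₀` agree («`h_{𝒪_{𝓜,x₀}} ≅ Def_{P₀}`»,
[Schlessinger1968] §2 `h_R`; the Yoneda lemma inside MFK's test category), in RELATION FORM:

* `comp_classifyingMap_eq_of_isBaseChangeVia` — (deformations ⇒ points) a triple `P'` over `T` whose fibre along `ι` is `P₀`
  is classified by a morphism THROUGH `x₀`: `ι ≫ cls P' = x₀` (★ `classifyingMap_comp`);
* `exists_triple_of_comp_eq_classifyingMap` — (points ⇒ deformations) every `f : T → 𝓜.M` with `ι ≫ f = x₀` classifies a triple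
  `P' = f^*univ` over `T` whose fibre along `ι` IS `P₀` up to isomorphism (★ D-BC∃ `PolarizedAbelianSchemeWithLevel.exists_isBaseChangeVia`
  twice, ★ `exists_isBaseChangeVia_id_of_classifyingMap_eq`, ★ `IsBaseChangeVia.trans`);
* `classifyingMap_eq_iff_exists_isBaseChangeVia_id` — (injectivity on isomorphism classes) two triples over `T` have the same
  classifying map iff they are related along `𝟙 T`;
* naturality in the pointed base is ★ `classifyingMap_comp` itself (no restatement).

Cell `hodgecm-mathlib`, SOCKETS-F §4 (α) node E1-mod (census `B-provers/B-p19/F-census/E-census-E1mod.B-p19g11.md` 9899226b);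
consumer: the Yoneda tangent bridge `T_{x₀} 𝓜.M ≅ Def_{P₀}(ℂ[ε])` (E1-gen, A-p15 (g9)) and E2–E4.  Presearch: MFK Ch. 7 §2–§3
(held), Schlessinger §2; the pointed relation form is folklore (Yoneda).  HC_CM is proved only modulo the 7 printed citations
until rung 0 closes — this file asserts nothing about HC.

## References
* D. Mumford, J. Fogarty, F. Kirwan, *Geometric Invariant Theory*, 3rd ed. (1994), Ch. 7 §2 Definitions 7.2–7.3 (p. 129),
  §3 Theorem 7.9 (p. 139). [MumfordFogartyKirwan1994]
* M. Schlessinger, *Functors of Artin rings*, Trans. AMS 130 (1968), §2 (the functors `h_R`). [Schlessinger1968]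
-/

noncomputable section

open CategoryTheory CategoryTheory.Limits AlgebraicGeometry
open Literature.AlgebraicGeometry.Motives (SchemeOver AlgPoints specOver)
open Literature.AlgebraicGeometry.AbelianSchemes (PolarizedAbelianSchemeWithLevel)

namespace Literature.AlgebraicGeometry.ModuliOfAbelianVarieties

namespace SiegelFineModuliScheme

variable {g N : ℕ} {δ : Fin g → ℕ} (𝓜 : SiegelFineModuliScheme g N δ)

/-- `Spec ℂ` over `ℚ` is locally noetherian (a field). [cite: MumfordFogartyKirwan1994, Ch. 7 §2 Definition 7.2 (p. 129)] -/
theorem isLocallyNoetherian_specOver_complex : IsLocallyNoetherian (specOver ℚ ℂ).left :=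
  inferInstanceAs (IsLocallyNoetherian (Spec (CommRingCat.of ℂ)))

/-- **Deformations ⇒ points through `x₀`**: a triple `P'` over the pointed base `(T, ι)` whose fibre along `ι : Spec ℂ → T`
is `P₀` is classified by a morphism through the classifying point of `P₀`: `ι ≫ cls P' = cls P₀`.
[cite: MumfordFogartyKirwan1994, Ch. 7 §2 Definitions 7.2–7.3 (p. 129)] -/
theorem comp_classifyingMap_eq_of_isBaseChangeVia {T : SchemeOver ℚ} [IsLocallyNoetherian T.left]
    (ι : specOver ℚ ℂ ⟶ T) (P' : PolarizedAbelianSchemeWithLevel g N δ T.left)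
    (P₀ : PolarizedAbelianSchemeWithLevel g N δ (specOver ℚ ℂ).left)
    {H : P₀.A.X.left ⟶ P'.A.X.left} {Ĥ : P₀.D.hat.X.left ⟶ P'.D.hat.X.left} (h : P₀.IsBaseChangeVia P' ι.left H Ĥ) :
    haveI := isLocallyNoetherian_specOver_complex
    ι ≫ 𝓜.classifyingMap T P' = 𝓜.classifyingMap (specOver ℚ ℂ) P₀ :=
  haveI := isLocallyNoetherian_specOver_complex
  𝓜.classifyingMap_comp ι P' P₀ h

/-- **Points through `x₀` ⇒ deformations**: every `ℚ`-morphism `f : T → 𝒜_{g,δ,N}` sending the base point `ι` to the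
classifying point of `P₀` classifies a triple over `T` — the pull-back `f^* univ` — whose fibre along `ι` is `P₀` up to an
isomorphism of triples over `Spec ℂ` (both fibres classify to `cls P₀`, and a fine moduli scheme is injective on isomorphism
classes). [cite: MumfordFogartyKirwan1994, Ch. 7 §3 Theorem 7.9 (p. 139)] -/
theorem exists_triple_of_comp_eq_classifyingMap {T : SchemeOver ℚ} [IsLocallyNoetherian T.left]
    (ι : specOver ℚ ℂ ⟶ T) (P₀ : PolarizedAbelianSchemeWithLevel g N δ (specOver ℚ ℂ).left) (f : T ⟶ 𝓜.M)
    (hf : haveI := isLocallyNoetherian_specOver_complex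
      ι ≫ f = 𝓜.classifyingMap (specOver ℚ ℂ) P₀) :
    ∃ P' : PolarizedAbelianSchemeWithLevel g N δ T.left,
      (∃ (G : P'.A.X.left ⟶ 𝓜.univ.A.X.left) (Ĝ : P'.D.hat.X.left ⟶ 𝓜.univ.D.hat.X.left),
        P'.IsBaseChangeVia 𝓜.univ f.left G Ĝ) ∧
      ∃ (H : P₀.A.X.left ⟶ P'.A.X.left) (Ĥ : P₀.D.hat.X.left ⟶ P'.D.hat.X.left), P₀.IsBaseChangeVia P' ι.left H Ĥ := by
  haveI := isLocallyNoetherian_specOver_complex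
  -- the pull-back of the universal triple along `f`
  obtain ⟨P', G, Ĝ, hP'⟩ := PolarizedAbelianSchemeWithLevel.exists_isBaseChangeVia 𝓜.univ f.left
  refine ⟨P', ⟨G, Ĝ, hP'⟩, ?_⟩
  have hcls : 𝓜.classifyingMap T P' = f := 𝓜.classifyingMap_eq_of_isBaseChangeVia P' f hP'
  -- its fibre along `ι` classifies to `ι ≫ f = cls P₀`
  obtain ⟨Q, H₁, Ĥ₁, hQ⟩ := PolarizedAbelianSchemeWithLevel.exists_isBaseChangeVia P' ι.left
  have hclsQ : 𝓜.classifyingMap (specOver ℚ ℂ) Q = 𝓜.classifyingMap (specOver ℚ ℂ) P₀ := by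
    rw [← 𝓜.classifyingMap_comp ι P' Q hQ, hcls, hf]
  -- hence `P₀ ≅ Q` over `Spec ℂ`, and `P₀` is a pull-back of `P'` along `𝟙 ≫ ι = ι`
  obtain ⟨H₀, Ĥ₀, h₀⟩ := 𝓜.exists_isBaseChangeVia_id_of_classifyingMap_eq Q P₀ hclsQ.symm
  refine ⟨H₀ ≫ H₁, Ĥ₀ ≫ Ĥ₁, ?_⟩
  have h := h₀.trans hQ
  rwa [Category.id_comp] at h

/-- **Injectivity on isomorphism classes**: two triples over `T` have the same classifying map iff they are related along
`𝟙 T` (an isomorphism of triples) — «a fine moduli scheme represents the functor of isomorphism classes of triples».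
[cite: MumfordFogartyKirwan1994, Ch. 7 §2 Definition 7.2 (p. 129) and §3 Theorem 7.9 (p. 139)] -/
theorem classifyingMap_eq_iff_exists_isBaseChangeVia_id {T : SchemeOver ℚ} [IsLocallyNoetherian T.left]
    (P' P'' : PolarizedAbelianSchemeWithLevel g N δ T.left) :
    𝓜.classifyingMap T P' = 𝓜.classifyingMap T P'' ↔
      ∃ (H : P'.A.X.left ⟶ P''.A.X.left) (Ĥ : P'.D.hat.X.left ⟶ P''.D.hat.X.left),
        P'.IsBaseChangeVia P'' (𝟙 T.left) H Ĥ := by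
  refine ⟨fun h ↦ 𝓜.exists_isBaseChangeVia_id_of_classifyingMap_eq P'' P' h, ?_⟩
  rintro ⟨H, Ĥ, h⟩
  obtain ⟨G, Ĝ, h''⟩ := 𝓜.exists_isBaseChangeVia_classifyingMap T P''
  have ht := h.trans h''
  rw [Category.id_comp] at ht
  exact (𝓜.eq_classifyingMap T P' (𝓜.classifyingMap T P'') ⟨H ≫ G, Ĥ ≫ Ĝ, ht⟩).symm

/-- **The bridge, both directions at once**: the `ℚ`-morphisms `f : T → 𝒜_{g,δ,N}` with `ι ≫ f = cls P₀` are exactly the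
classifying maps of the triples over `T` deforming `P₀` (fibre along `ι` isomorphic to `P₀`).
[cite: MumfordFogartyKirwan1994, Ch. 7 §3 Theorem 7.9 (p. 139)] [cite: Schlessinger1968, §2 (the functors h_R)] -/
theorem comp_eq_classifyingMap_iff {T : SchemeOver ℚ} [IsLocallyNoetherian T.left]
    (ι : specOver ℚ ℂ ⟶ T) (P₀ : PolarizedAbelianSchemeWithLevel g N δ (specOver ℚ ℂ).left) (f : T ⟶ 𝓜.M) :
    haveI := isLocallyNoetherian_specOver_complex
    ι ≫ f = 𝓜.classifyingMap (specOver ℚ ℂ) P₀ ↔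
      ∃ P' : PolarizedAbelianSchemeWithLevel g N δ T.left, 𝓜.classifyingMap T P' = f ∧
        ∃ (H : P₀.A.X.left ⟶ P'.A.X.left) (Ĥ : P₀.D.hat.X.left ⟶ P'.D.hat.X.left), P₀.IsBaseChangeVia P' ι.left H Ĥ := by
  haveI := isLocallyNoetherian_specOver_complex
  constructor
  · intro hf
    obtain ⟨P', ⟨G, Ĝ, hP'⟩, hfib⟩ := 𝓜.exists_triple_of_comp_eq_classifyingMap ι P₀ f hf
    exact ⟨P', 𝓜.classifyingMap_eq_of_isBaseChangeVia P' f hP', hfib⟩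
  · rintro ⟨P', hcls, H, Ĥ, h⟩
    rw [← hcls]
    exact 𝓜.comp_classifyingMap_eq_of_isBaseChangeVia ι P' P₀ h

end SiegelFineModuliScheme

end Literature.AlgebraicGeometry.ModuliOfAbelianVarieties

end
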